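import Summits.QuantumFields.BalabanUV.Beta.GAN24.CombLegChainGauge
import Summits.QuantumFields.BalabanUV.Beta.GAN24.DressedLegSawtoothBlockL1

/-!
# `BalabanUV.Beta.GAN24.CombLegFaceSawtoothBlockL1` — binder row G-an2-4 ∕ (CONV-C), TRANSFER-III (the (III′) column of RULING R-gan24p1-g46-2), THE COMB LEG DICTIONARY,
# SECOND WORD: **THE FACE SAWTOOTH OF THE CONJUGATED (COMB-CHART) COMPOSITE LEGS IS `T^B`-SIZED IN BLOCK-ℓ¹** — the (III′) twin of the OWNER's part 1
# `GAN24/DressedLegSawtoothBlockL1` for the face term `dz (PsiFace r ρ Lc m k (single μ z))` of the first word `GAN24/CombLegChainGauge` (OWNER `b2b-balaban-gan24-p1` gen 47)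

NOT IN PRINT; OUR BOOKKEEPING ([folklore] face counting on `ℤ^{3+1}` BY NAME over the first word, leaf-03 g41's `RespStepBmDecompPsi.legAct_legChain_respStepBm`, leaf-01 g57's
`DressedLegEnvelope.bmGaugeAt_respStep_envelope`, the OWNER's `StaircaseFaces`, leaf-03 g54's `StaircaseFaceDensity.card_box_filter_dvd`; 0 `def`, 0 cited facts, 0 `def … : Prop`,
0 sorry).  HONEST FRAMING (cell contract, verbatim): «discharging `BetaPertH` makes Bałaban's UV stability UNCONDITIONAL — a real constructive-QFT result; it is NOT the continuum limit
and NOT the Clay problem.»  HONEST DEPENDENCY (verbatim): «continuum YM on T⁴ ⇐ BetaPertH ∧ nine spine estimates (0/9 proved); BetaPertH ⇐ (D1) ∧ (D4) ∧ CAP+tail; G-an2-4 gates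
asym, D1 and NE2/3/4.»

WHY (`gen47/LEG-DICTIONARY-SIZING.v0_1.md` §2).  The (III′) composite leg is the (E) one plus `dz PsiFace` (first word), `PsiFace m k b = Σ_{i ≤ k} (Lc^{(d+1) i})⁻¹ · facePotential
(legAct (legChain R (m+i) (k−i)) b) ∘ blk (Lc^i)` (§1, the fine-end recursion unrolled).  THE CURRENCY THAT WORKS: each face potential in SUP currency (`abs_facePotential_le_of_abs_le`)
OF `Π^ρ_bm` OF THE UNDRESSED PARTIAL RESPONSE — the (E) partial output is `Π^ρ_bm T^B + dz Ψ` with `Ψ` `ext Lc`-shaped, whose face potential VANISHES (§1 `Psi_eq_ext`, nilpotency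
`facePotential_dz_ext`); `Π^ρ_bm T^B` keeps (N1)'s `(Lc^{5(j+1)})⁻¹` in sup (§2), so the level-`i` term has amplitude `∝ Lc^{−5(k−i+1) − 4i}`, its `dz` lives on the `Lc^{i+1}`-faces
(density `Lc^{−(i+1)}`), and its block mass over a source block (`(Lc^{k+1})^4` sites) is `∝ Lc^{−(k+2)}` — INDEPENDENT OF `i`, one power of `Lc` better than part 1; `k+1` levels.
WHAT (`d = 3` from §2 on, `[NeZero Lc]`, in-block roots `r` (face weights of `Ψ̂_S`) and `ρ = toSite rr` (dressing); PARAMETRIC in leaf-12's (N1) data `κ₀ ≥ 0`, `C ≥ 0` as part 1):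
§1 (generic `d`) `facePotential_add`, `Psi_eq_ext`, `facePotential_legAct_legChain_eq`, `PsiFace_apply_eq_sum`, `dz_PsiFace_apply`; §2 `abs_axProjBmAt_respStep_single_le`
(`|Π^ρ_bm T^B_{n,j} κ u| ≤ (1 + 8·Lc·(e^{κ₀}+1))·C·(Lc^{5(j+1)})⁻¹·E_j(u)` — part 2's `hproj` isolated), `abs_facePotential_legChain_single_le` (`faceWtSum r Lc ×` the same);
§3 `abs_dz_PsiFaceTerm_single_le` (zero off the `Lc^{i+1}`-faces, `≤ 2·amplitude·e^{κ₀}·E` on them), `dvd_coord_iff_of_le`, **`sum_box_abs_dz_PsiFaceTerm_single_le`** (per level,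
`≤ 2·faceWtSum·(1 + 8·Lc·(e^{κ₀}+1))·e^{κ₀}·C·(Lc^{k+2})⁻¹·e^{−κ₀‖c − z‖∞}`); §4 **`sum_box_abs_dz_PsiFace_single_le`** — for ALL `m k μ z κ c`,
`Σ_{t ∈ box (Lc^{k+1})} |dz (PsiFace r ρ Lc m k (single μ z)) κ (Lc^{k+1}•c + t)| ≤ 2·(k+1)·faceWtSum r Lc·(1 + 8·Lc·(e^{κ₀}+1))·e^{κ₀}·C·(Lc^{k+2})⁻¹·e^{−κ₀‖c − z‖∞}` (and `…_le'`
in part 1's currency `(Lc^{k+1})⁻¹`).  Asserts NOTHING about Bałaban's tables; NOT the (III′) leg envelope (next word: decomposition + part 2 + this file), NOT L11–L13, NOT a letter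
row; the (III′) campaign is NOT asked (an2 W-4); NEVER «G-an2-4 closed» as (CONV-C); NOT D1, NOT `BetaPertH`, NOT continuum, NOT Clay.  2026-08-25; no existing file touched.
-/

noncomputable section

open Finset
open scoped BigOperators
open Literature.MathematicalPhysics.QuantumFieldTheory
open Literature.MathematicalPhysics.QuantumFieldTheory.LatticeForm (quo)
open Literature.MathematicalPhysics.QuantumFieldTheory.Balaban1983to89
open Literature.MathematicalPhysics.QuantumFieldTheory.Balaban1983to89.Beta
open B4ContourShift (supNorm)
open AffineAveraging (Form0 Form1 Site box toSite unitVec dz)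
open AveragingContours (blk blk_block grad_eq_dz)
open BalabanCompositeJets (respStep)
open KKTFluctuationEnergy (quo_zsmul_add_toSite)
open Summit.QuantumFields.BalabanUV.Beta.AxialProjectorBlockMean (bmGaugeAt axProjBmAt)
open Summit.QuantumFields.BalabanUV.Beta.CompositeCorrectorForms (ext)
open Summit.QuantumFields.BalabanUV.Beta.SymCorrectorForms (zetaS zetaS_add)
open Summit.QuantumFields.BalabanUV.Beta.SymCorrectorFace (faceWtSum faceWtSum_nonneg)
open Summit.QuantumFields.BalabanUV.Beta.GAN24.Push4Iter (legChain legChain_zero)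
open Summit.QuantumFields.BalabanUV.Beta.GAN24.RespStepBmDecomp (blk_blk)
open Summit.QuantumFields.BalabanUV.Beta.GAN24.RespStepBmDecompLegs (legAct)
open Summit.QuantumFields.BalabanUV.Beta.GAN24.RespStepBmDecompExact (respStepBmSeq)
open Summit.QuantumFields.BalabanUV.Beta.GAN24.RespStepBmDecompPsi (Psi Psi_apply legAct_legChain_respStepBm)
open Summit.QuantumFields.BalabanUV.Beta.GAN24.DressedLegEnvelope (bmGaugeAt_respStep_envelope blk_pow_blk_pow legAct_single summable_single_and_le)
open Summit.QuantumFields.BalabanUV.Beta.GAN24.StaircaseFaces (blk_add_unitVec_of_not_dvd env_add_unitVec_le blk_one)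
open Summit.QuantumFields.BalabanUV.Beta.GAN24.StaircaseFaceDensity (card_box_filter_dvd)
open Summit.QuantumFields.BalabanUV.Beta.GAN24.CombLegChainGauge (facePotential facePotential_apply facePotential_dz_ext abs_facePotential_le_of_abs_le
  PsiFace PsiFace_zero PsiFace_succ)

namespace Summit.QuantumFields.BalabanUV.Beta.GAN24.CombLegFaceSawtoothBlockL1

variable {d : ℕ}

/-! ## §1 The face potential of a dressed partial-chain output; the fine-end recursion unrolled (generic dimension) -/

/-- [folklore] The face potential is additive (`ζ_S` is: d1-formalise-leaf-03's `zetaS_add`). -/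
theorem facePotential_add (r : Fin (d + 1) → ℕ) (n : ℕ) (A B : Form1 (d + 1) ℝ) :
    facePotential r n (A + B) = facePotential r n A + facePotential r n B := by
  funext x
  simp only [Pi.add_apply, facePotential_apply, zetaS_add, mul_add]

section Dressed

variable {Lc : ℕ} [NeZero Lc]

/-- [folklore] **leaf-03's INTER-BLOCK GAUGE `Ψ` IS `ext Lc` OF A STAIRCASE**: every level's term reads `x` through `blk (Lc^(i+1)) x = blk (Lc^i) (blk Lc x)`, so
`Psi ρ Lc m k b = ext Lc (Y ↦ −Σ_{i<k} (Lc^{(d+1)(i+1)})⁻¹ · bmGaugeAt ρ (…) Lc (blk (Lc^i) Y))`. -/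
theorem Psi_eq_ext (ρ : Fin (d + 1) → ℤ) (m k : ℕ) (b : Form1 (d + 1) ℝ) :
    Psi ρ Lc m k b = ext Lc (fun Y => -∑ i ∈ Finset.range k, ((Lc : ℝ) ^ ((d + 1) * (i + 1)))⁻¹ *
      bmGaugeAt ρ (legAct (respStep (d := d) (Lc ^ (m + i + 1)) (Lc ^ (m + k + 1))) b) Lc (blk (Lc ^ i) Y)) := by
  funext x
  rw [Psi_apply]
  show _ = -∑ i ∈ Finset.range k, ((Lc : ℝ) ^ ((d + 1) * (i + 1)))⁻¹ *
      bmGaugeAt ρ (legAct (respStep (d := d) (Lc ^ (m + i + 1)) (Lc ^ (m + k + 1))) b) Lc (blk (Lc ^ i) (blk Lc x))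
  refine congrArg Neg.neg (Finset.sum_congr rfl fun i _ => ?_)
  rw [blk_blk, ← pow_succ']

variable {r : Fin (d + 1) → ℕ} (hr : r ∈ box (d + 1) Lc) {rr : Fin (d + 1) → ℕ} (hrr : rr ∈ box (d + 1) Lc)
include hr hrr

/-- [folklore] **THE FACE POTENTIAL OF A DRESSED PARTIAL-CHAIN OUTPUT IS THAT OF `Π^ρ_bm` OF THE UNDRESSED RESPONSE** (summable datum): leaf-03's decomposition
`legAct (legChain R n j) b = Π^ρ_bm (…) + dz Ψ`, additivity, NILPOTENCY (`Ψ` is `ext Lc`-shaped, `Psi_eq_ext`; first word `facePotential_dz_ext`). -/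
theorem facePotential_legAct_legChain_eq (n j : ℕ) {b : Form1 (d + 1) ℝ} (hb : ∀ μ, Summable (b μ)) :
    facePotential r Lc (legAct (legChain (respStepBmSeq (d := d) (toSite rr) Lc) n j) b)
      = facePotential r Lc (axProjBmAt (toSite rr) Lc (legAct (respStep (d := d) (Lc ^ n) (Lc ^ (n + j + 1))) b)) := by
  rw [legAct_legChain_respStepBm hrr n j hb, facePotential_add, Psi_eq_ext, facePotential_dz_ext hr, add_zero]

omit hr hrr in
/-- [folklore] **THE FIRST WORD's FINE-END RECURSION, UNROLLED**: `PsiFace r ρ Lc m k b x = Σ_{i ≤ k} (Lc^{(d+1) i})⁻¹ · facePotential r Lc (legAct (legChain R (m+i) (k−i)) b)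
(blk (Lc^i) x)` (`R = respStepBmSeq ρ Lc`) — one face potential per level `m+i`, each of the (E) PARTIAL-CHAIN OUTPUT on the same datum, read `i` levels down. -/
theorem PsiFace_apply_eq_sum (ρ : Fin (d + 1) → ℤ) (k : ℕ) :
    ∀ (m : ℕ) (b : Form1 (d + 1) ℝ) (x : Site (d + 1)),
      PsiFace r ρ Lc m k b x = ∑ i ∈ Finset.range (k + 1), ((Lc : ℝ) ^ ((d + 1) * i))⁻¹ *
        facePotential r Lc (legAct (legChain (respStepBmSeq (d := d) ρ Lc) (m + i) (k - i)) b) (blk (Lc ^ i) x) := by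
  induction k with
  | zero =>
    intro m b x
    rw [PsiFace_zero, Finset.sum_range_one]
    simp [legChain_zero, blk_one]
  | succ k ih =>
    intro m b x
    rw [PsiFace_succ, Pi.add_apply, Pi.smul_apply, smul_eq_mul, ih (m + 1) b (blk Lc x), Finset.sum_range_succ' _ (k + 1),
      Finset.mul_sum, add_comm]
    congr 1
    · refine Finset.sum_congr rfl fun i _ => ?_
      rw [← mul_assoc, ← mul_inv, ← pow_add, blk_blk, ← pow_succ', Nat.add_sub_add_right,
        show m + 1 + i = m + (i + 1) by omega, show d + 1 + (d + 1) * i = (d + 1) * (i + 1) by ring]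
    · simp [blk_one]

omit hr hrr in
/-- [folklore] The `κ`-gradient of `PsiFace` is the sum of the level gradients. -/
theorem dz_PsiFace_apply (ρ : Fin (d + 1) → ℤ) (m k : ℕ) (b : Form1 (d + 1) ℝ) (κ : Fin (d + 1)) (y : Site (d + 1)) :
    dz (PsiFace r ρ Lc m k b) κ y
      = ∑ i ∈ Finset.range (k + 1),
          (((Lc : ℝ) ^ ((d + 1) * i))⁻¹ *
              facePotential r Lc (legAct (legChain (respStepBmSeq (d := d) ρ Lc) (m + i) (k - i)) b) (blk (Lc ^ i) (y + unitVec κ))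
            - ((Lc : ℝ) ^ ((d + 1) * i))⁻¹ *
              facePotential r Lc (legAct (legChain (respStepBmSeq (d := d) ρ Lc) (m + i) (k - i)) b) (blk (Lc ^ i) y)) := by
  simp only [dz, PsiFace_apply_eq_sum, Finset.sum_sub_distrib]

end Dressed

/-! ## §2 `d = 3`: the projector of the undressed column in sup; the face potential of a dressed partial output -/

section Four

variable {Lc : ℕ} [NeZero Lc] {κ₀ C : ℝ} (hκ : 0 ≤ κ₀) (hC : 0 ≤ C)
  (hN1 : ∀ (m k : ℕ) (μ : Fin (3 + 1)) (z : Site (3 + 1)) (l'' : Fin (3 + 1)) (w' : Site (3 + 1)),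
    |respStep (d := 3) (Lc ^ m) (Lc ^ (m + k + 1)) μ z l'' w'| ≤
      C * ((Lc : ℝ) ^ (5 * (k + 1)))⁻¹ * Real.exp (-(κ₀ * supNorm (quo (Lc ^ (k + 1)) w' - z))))
  {r : Fin (3 + 1) → ℕ} (hr : r ∈ box (3 + 1) Lc) {rr : Fin (3 + 1) → ℕ} (hrr : rr ∈ box (3 + 1) Lc)
include hκ hC hN1 hr hrr

omit hr in
/-- NOT IN PRINT; OUR BOOKKEEPING.  **`Π^ρ_bm` OF THE UNDRESSED COMPOSITE COLUMN KEEPS (N1)'s ENVELOPE AND POWER** (the `hproj` step of leaf-01 g57's `exists_legChain_envelope` ∕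
the OWNER's part 2, isolated, PARAMETRIC; `d = 3`, in-block root): for `T^B_{n,j} := legAct (respStep (Lc^n) (Lc^(n+j+1))) (single μ z)` and ALL `n j μ z κ u`,
`|Π^ρ_bm T^B_{n,j} κ u| ≤ (1 + 8·Lc·(e^{κ₀} + 1))·C·(Lc^{5(j+1)})⁻¹·e^{−κ₀‖quo (Lc^{j+1}) u − z‖∞}` ((N1) + the rooted gauges at `u + e_κ`, `u`; the unit shift costs `e^{κ₀}`). -/
theorem abs_axProjBmAt_respStep_single_le (n j : ℕ) (μ : Fin (3 + 1)) (z : Site (3 + 1)) (κ : Fin (3 + 1)) (u : Site (3 + 1)) :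
    |axProjBmAt (toSite rr) Lc (legAct (respStep (d := 3) (Lc ^ n) (Lc ^ (n + j + 1)))
        (fun μ' y => if μ' = μ then (if y = z then (1 : ℝ) else 0) else 0)) κ u|
      ≤ (1 + 8 * (Lc : ℝ) * (Real.exp κ₀ + 1)) * C * ((Lc : ℝ) ^ (5 * (j + 1)))⁻¹ *
          Real.exp (-(κ₀ * supNorm (quo (Lc ^ (j + 1)) u - z))) := by
  haveI : NeZero (Lc ^ (j + 1)) := ⟨pow_ne_zero _ (NeZero.ne Lc)⟩
  have hcol : ∀ (κ' : Fin (3 + 1)) (w : Site (3 + 1)),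
      |legAct (respStep (d := 3) (Lc ^ n) (Lc ^ (n + j + 1))) (fun μ' y => if μ' = μ then (if y = z then (1 : ℝ) else 0) else 0) κ' w|
        ≤ C * ((Lc : ℝ) ^ (5 * (j + 1)))⁻¹ * Real.exp (-(κ₀ * supNorm (quo (Lc ^ (j + 1)) w - z))) := by
    intro κ' w
    rw [legAct_single]
    exact hN1 n j μ z κ' w
  have hgauge : ∀ w : Site (3 + 1),
      |bmGaugeAt (toSite rr) (legAct (respStep (d := 3) (Lc ^ n) (Lc ^ (n + j + 1)))
          (fun μ' y => if μ' = μ then (if y = z then (1 : ℝ) else 0) else 0)) Lc w|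
        ≤ 8 * (Lc : ℝ) * C * ((Lc : ℝ) ^ (5 * (j + 1)))⁻¹ * Real.exp (-(κ₀ * supNorm (quo (Lc ^ (j + 1)) w - z))) := by
    intro w
    have h := bmGaugeAt_respStep_envelope (Lc := Lc) hN1 hrr n j (n + j + 1) rfl μ z w
    have hlab : blk (Lc ^ j) (blk Lc w) = quo (Lc ^ (j + 1)) w := by
      show _ = blk (Lc ^ (j + 1)) w
      rw [blk_blk, ← pow_succ']
    rwa [hlab] at h
  unfold axProjBmAt
  rw [Pi.sub_apply, Pi.sub_apply, grad_eq_dz]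
  simp only [dz]
  have h0 := hcol κ u
  have h1 := hgauge (u + unitVec κ)
  have h2 := hgauge u
  have h3 := env_add_unitVec_le (N := Lc ^ (j + 1)) hκ z u κ
  have hA : 0 ≤ 8 * (Lc : ℝ) * C * ((Lc : ℝ) ^ (5 * (j + 1)))⁻¹ := by positivity
  have h1' := h1.trans (mul_le_mul_of_nonneg_left h3 hA)
  refine ((abs_sub _ _).trans (add_le_add h0 ((abs_sub _ _).trans (add_le_add h1' h2)))).trans (le_of_eq ?_)
  ring

/-- NOT IN PRINT; OUR BOOKKEEPING.  **THE FACE POTENTIAL OF A DRESSED PARTIAL-CHAIN OUTPUT, IN SUP CURRENCY** (`d = 3`, in-block roots): for ALL `n j μ z x`,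
`|facePotential r Lc (legAct (legChain R n j) (single μ z)) x| ≤ faceWtSum r Lc·(1 + 8·Lc·(e^{κ₀}+1))·C·(Lc^{5(j+1)})⁻¹·e^{−κ₀‖quo (Lc^{j+1}) x − z‖∞}` — only `Π^ρ_bm T^B` is seen (§1),
the weights over the `Lc`-block of `x` sum to `faceWtSum` (first word), and that block has the source-scale label of `x`: NO power of the relative blocking is lost to the dressing. -/
theorem abs_facePotential_legChain_single_le
    (n j : ℕ) (μ : Fin (3 + 1)) (z : Site (3 + 1)) (x : Site (3 + 1)) :
    |facePotential r Lc (legAct (legChain (respStepBmSeq (d := 3) (toSite rr) Lc) n j)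
        (fun μ' y => if μ' = μ then (if y = z then (1 : ℝ) else 0) else 0)) x|
      ≤ faceWtSum r Lc * ((1 + 8 * (Lc : ℝ) * (Real.exp κ₀ + 1)) * C * ((Lc : ℝ) ^ (5 * (j + 1)))⁻¹ *
          Real.exp (-(κ₀ * supNorm (quo (Lc ^ (j + 1)) x - z)))) := by
  obtain ⟨hsum, -⟩ := summable_single_and_le (d := 3) μ z
  rw [facePotential_legAct_legChain_eq hr hrr n j hsum]
  refine abs_facePotential_le_of_abs_le (Nat.pos_of_ne_zero (NeZero.ne Lc)) hr _ x fun α b hb => ?_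
  have h := abs_axProjBmAt_respStep_single_le hκ hC hN1 hrr n j μ z α (((Lc : ℕ) : ℤ) • blk Lc x + toSite b)
  have hlab : quo (Lc ^ (j + 1)) (((Lc : ℕ) : ℤ) • blk Lc x + toSite b) = quo (Lc ^ (j + 1)) x := by
    show blk (Lc ^ (j + 1)) (((Lc : ℕ) : ℤ) • blk Lc x + toSite b) = blk (Lc ^ (j + 1)) x
    rw [pow_succ', ← blk_blk, ← blk_blk, blk_block (blk Lc x) hb]
  rw [hlab] at h
  exact h

/-! ## §3 One level's face jump; one level's face sawtooth in block-ℓ¹ over a source block -/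

/-- NOT IN PRINT; OUR BOOKKEEPING.  **THE FACE JUMP OF ONE LEVEL's TERM** (`d = 3`, `i ≤ k`): the `κ`-gradient of the level-`i` term of `PsiFace m k (single μ z)` VANISHES off the
`Lc^{i+1}`-faces (a face potential is BLOCK-CONSTANT at blocking `Lc`, here read through `blk (Lc^i)`: `StaircaseFaces.blk_add_unitVec_of_not_dvd`) and is at most twice the
amplitude, one step wobbled (`e^{κ₀}`), on them — with the SOURCE-SCALE envelope (`quo (Lc^{k−i+1}) ∘ blk (Lc^i) = quo (Lc^{k+1})`). -/
theorem abs_dz_PsiFaceTerm_single_le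
    (m k i : ℕ) (hik : i ≤ k) (μ : Fin (3 + 1)) (z : Site (3 + 1)) (κ : Fin (3 + 1)) (y : Site (3 + 1)) :
    |((Lc : ℝ) ^ ((3 + 1) * i))⁻¹ *
        facePotential r Lc (legAct (legChain (respStepBmSeq (d := 3) (toSite rr) Lc) (m + i) (k - i))
          (fun μ' y => if μ' = μ then (if y = z then (1 : ℝ) else 0) else 0)) (blk (Lc ^ i) (y + unitVec κ))
      - ((Lc : ℝ) ^ ((3 + 1) * i))⁻¹ *
        facePotential r Lc (legAct (legChain (respStepBmSeq (d := 3) (toSite rr) Lc) (m + i) (k - i))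
          (fun μ' y => if μ' = μ then (if y = z then (1 : ℝ) else 0) else 0)) (blk (Lc ^ i) y)|
      ≤ if ((Lc ^ (i + 1) : ℕ) : ℤ) ∣ y κ + 1 then
          2 * faceWtSum r Lc * (1 + 8 * (Lc : ℝ) * (Real.exp κ₀ + 1)) * C * ((Lc : ℝ) ^ (5 * (k - i + 1)))⁻¹ *
            ((Lc : ℝ) ^ ((3 + 1) * i))⁻¹ * Real.exp κ₀ * Real.exp (-(κ₀ * supNorm (quo (Lc ^ (k + 1)) y - z)))
        else 0 := by
  have hL0 : (0 : ℝ) < Lc := by exact_mod_cast Nat.pos_of_ne_zero (NeZero.ne Lc)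
  have hP : 1 ≤ Lc ^ (i + 1) := Nat.one_le_pow _ _ (Nat.pos_of_ne_zero (NeZero.ne Lc))
  haveI : NeZero (Lc ^ (k + 1)) := ⟨pow_ne_zero _ (NeZero.ne Lc)⟩
  -- the source-scale label seen from level `m+i`
  have hlab : ∀ w : Site (3 + 1), quo (Lc ^ (k - i + 1)) (blk (Lc ^ i) w) = quo (Lc ^ (k + 1)) w := by
    intro w
    show blk (Lc ^ (k - i + 1)) (blk (Lc ^ i) w) = blk (Lc ^ (k + 1)) w
    rw [blk_pow_blk_pow, show i + (k - i + 1) = k + 1 by omega]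
  by_cases hdvd : ((Lc ^ (i + 1) : ℕ) : ℤ) ∣ y κ + 1
  · rw [if_pos hdvd]
    set E : ℝ := Real.exp (-(κ₀ * supNorm (quo (Lc ^ (k + 1)) y - z))) with hE
    have hE0 : 0 ≤ E := (Real.exp_pos _).le
    have h1 := abs_facePotential_legChain_single_le hκ hC hN1 hr hrr (m + i) (k - i) μ z (blk (Lc ^ i) (y + unitVec κ))
    have h0 := abs_facePotential_legChain_single_le hκ hC hN1 hr hrr (m + i) (k - i) μ z (blk (Lc ^ i) y)
    rw [hlab] at h1 h0
    have hw := env_add_unitVec_le (N := Lc ^ (k + 1)) hκ z y κ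
    rw [← hE] at h0 hw
    have hEle : E ≤ Real.exp κ₀ * E := by
      calc E = 1 * E := (one_mul E).symm
        _ ≤ Real.exp κ₀ * E := mul_le_mul_of_nonneg_right (Real.one_le_exp hκ) hE0
    have hB0 : 0 ≤ (1 + 8 * (Lc : ℝ) * (Real.exp κ₀ + 1)) * C * ((Lc : ℝ) ^ (5 * (k - i + 1)))⁻¹ := by positivity
    have hF0 := faceWtSum_nonneg r Lc
    -- both values: amplitude × (wobbled) envelope
    have H1 := h1.trans (mul_le_mul_of_nonneg_left (mul_le_mul_of_nonneg_left hw hB0) hF0)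
    have H0 := h0.trans (mul_le_mul_of_nonneg_left (mul_le_mul_of_nonneg_left hEle hB0) hF0)
    rw [← mul_sub, abs_mul, abs_inv, abs_pow, abs_of_pos hL0]
    calc _ ≤ ((Lc : ℝ) ^ ((3 + 1) * i))⁻¹ *
            (faceWtSum r Lc * ((1 + 8 * (Lc : ℝ) * (Real.exp κ₀ + 1)) * C * ((Lc : ℝ) ^ (5 * (k - i + 1)))⁻¹ * (Real.exp κ₀ * E))
              + faceWtSum r Lc * ((1 + 8 * (Lc : ℝ) * (Real.exp κ₀ + 1)) * C * ((Lc : ℝ) ^ (5 * (k - i + 1)))⁻¹ * (Real.exp κ₀ * E))) :=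
          mul_le_mul_of_nonneg_left ((abs_sub _ _).trans (add_le_add H1 H0)) (by positivity)
      _ = _ := by ring
  · rw [if_neg hdvd, facePotential_apply, facePotential_apply, blk_blk, blk_blk, ← pow_succ, blk_add_unitVec_of_not_dvd hP hdvd, sub_self, abs_zero]

omit [NeZero Lc] hκ hC hN1 hr hrr in
/-- [folklore] On the source block `L•c + box L` (`L = Lc^{k+1}`, `i ≤ k`) the face condition of scale `Lc^{i+1}` reads on the OFFSET (part 1's `dvd_coord_iff`, the case `i = k` included). -/
theorem dvd_coord_iff_of_le (k i : ℕ) (hik : i ≤ k) (c : Site (3 + 1)) (t : Fin (3 + 1) → ℕ) (κ : Fin (3 + 1)) :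
    ((Lc ^ (i + 1) : ℕ) : ℤ) ∣ ((((Lc ^ (k + 1) : ℕ) : ℤ) • c + toSite t) κ + 1) ↔ Lc ^ (i + 1) ∣ t κ + 1 := by
  have hdivL : ((Lc ^ (i + 1) : ℕ) : ℤ) ∣ ((Lc ^ (k + 1) : ℕ) : ℤ) := by
    exact_mod_cast pow_dvd_pow Lc (by omega : i + 1 ≤ k + 1)
  have e : ((((Lc ^ (k + 1) : ℕ) : ℤ) • c + toSite t) κ + 1) = ((Lc ^ (k + 1) : ℕ) : ℤ) * c κ + ((t κ + 1 : ℕ) : ℤ) := by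
    simp only [Pi.add_apply, Pi.smul_apply, smul_eq_mul, toSite]
    push_cast
    ring
  rw [e, Int.dvd_add_right (Dvd.dvd.mul_right hdivL _), Int.natCast_dvd_natCast]

/-- NOT IN PRINT; OUR BOOKKEEPING.  **ONE LEVEL's FACE SAWTOOTH IN BLOCK-ℓ¹ IS `T^B∕Lc`-SIZED, INDEPENDENTLY OF THE LEVEL** (`d = 3`, in-block roots, `i ≤ k`): over the source block
of label `c` (`L = Lc^{k+1}` fine sites per side), the level-`i` term's `κ`-gradient has block mass
`≤ 2·faceWtSum r Lc·(1 + 8·Lc·(e^{κ₀}+1))·e^{κ₀}·C·(Lc^{k+2})⁻¹·e^{−κ₀‖c − z‖∞}` — the `L^3·(L∕Lc^{i+1})` face sites (`StaircaseFaceDensity.card_box_filter_dvd`) times the jump;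
the exponents cancel: `3(k+1) + (k−i) = 5(k−i+1) + 4i − (k+2)`. -/
theorem sum_box_abs_dz_PsiFaceTerm_single_le
    (m k i : ℕ) (hik : i ≤ k) (μ : Fin (3 + 1)) (z : Site (3 + 1)) (κ : Fin (3 + 1)) (c : Site (3 + 1)) :
    ∑ t ∈ box (3 + 1) (Lc ^ (k + 1)),
      |((Lc : ℝ) ^ ((3 + 1) * i))⁻¹ *
          facePotential r Lc (legAct (legChain (respStepBmSeq (d := 3) (toSite rr) Lc) (m + i) (k - i))
            (fun μ' y => if μ' = μ then (if y = z then (1 : ℝ) else 0) else 0))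
              (blk (Lc ^ i) ((((Lc ^ (k + 1) : ℕ) : ℤ) • c + toSite t) + unitVec κ))
        - ((Lc : ℝ) ^ ((3 + 1) * i))⁻¹ *
          facePotential r Lc (legAct (legChain (respStepBmSeq (d := 3) (toSite rr) Lc) (m + i) (k - i))
            (fun μ' y => if μ' = μ then (if y = z then (1 : ℝ) else 0) else 0))
              (blk (Lc ^ i) (((Lc ^ (k + 1) : ℕ) : ℤ) • c + toSite t))|
      ≤ 2 * faceWtSum r Lc * (1 + 8 * (Lc : ℝ) * (Real.exp κ₀ + 1)) * Real.exp κ₀ * C * ((Lc : ℝ) ^ (k + 2))⁻¹ *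
          Real.exp (-(κ₀ * supNorm (c - z))) := by
  classical
  have hL0 : (0 : ℝ) < Lc := by exact_mod_cast Nat.pos_of_ne_zero (NeZero.ne Lc)
  have hne : (Lc : ℝ) ≠ 0 := hL0.ne'
  haveI : NeZero (Lc ^ (k + 1)) := ⟨pow_ne_zero _ (NeZero.ne Lc)⟩
  set E : ℝ := Real.exp (-(κ₀ * supNorm (c - z))) with hE
  set J : ℝ := 2 * faceWtSum r Lc * (1 + 8 * (Lc : ℝ) * (Real.exp κ₀ + 1)) * C * ((Lc : ℝ) ^ (5 * (k - i + 1)))⁻¹ *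
    ((Lc : ℝ) ^ ((3 + 1) * i))⁻¹ * Real.exp κ₀ * E with hJ
  -- every point of the source block carries the label `c`
  have hlab : ∀ t ∈ box (3 + 1) (Lc ^ (k + 1)), quo (Lc ^ (k + 1)) (((Lc ^ (k + 1) : ℕ) : ℤ) • c + toSite t) = c :=
    fun t ht => quo_zsmul_add_toSite c ht
  -- pointwise: the face jump on the faces, zero elsewhere
  have hpt : ∀ t ∈ box (3 + 1) (Lc ^ (k + 1)),
      |((Lc : ℝ) ^ ((3 + 1) * i))⁻¹ *
          facePotential r Lc (legAct (legChain (respStepBmSeq (d := 3) (toSite rr) Lc) (m + i) (k - i))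
            (fun μ' y => if μ' = μ then (if y = z then (1 : ℝ) else 0) else 0))
              (blk (Lc ^ i) ((((Lc ^ (k + 1) : ℕ) : ℤ) • c + toSite t) + unitVec κ))
        - ((Lc : ℝ) ^ ((3 + 1) * i))⁻¹ *
          facePotential r Lc (legAct (legChain (respStepBmSeq (d := 3) (toSite rr) Lc) (m + i) (k - i))
            (fun μ' y => if μ' = μ then (if y = z then (1 : ℝ) else 0) else 0))
              (blk (Lc ^ i) (((Lc ^ (k + 1) : ℕ) : ℤ) • c + toSite t))|
        ≤ if Lc ^ (i + 1) ∣ t κ + 1 then J else 0 := by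
    intro t ht
    have h := abs_dz_PsiFaceTerm_single_le hκ hC hN1 hr hrr m k i hik μ z κ (((Lc ^ (k + 1) : ℕ) : ℤ) • c + toSite t)
    rw [hlab t ht] at h
    by_cases hd : Lc ^ (i + 1) ∣ t κ + 1
    · rw [if_pos ((dvd_coord_iff_of_le (Lc := Lc) k i hik c t κ).2 hd)] at h
      rw [if_pos hd]; exact h.trans (le_of_eq (by rw [hJ]))
    · rw [if_neg (fun h' => hd ((dvd_coord_iff_of_le (Lc := Lc) k i hik c t κ).1 h'))] at h
      rw [if_neg hd]; exact h
  refine (Finset.sum_le_sum hpt).trans ?_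
  rw [Finset.sum_ite, Finset.sum_const_zero, add_zero, Finset.sum_const, nsmul_eq_mul,
    card_box_filter_dvd (Lc ^ (k + 1)) (Lc ^ (i + 1)) κ]
  -- the face count `L^3 · (L / Lc^{i+1}) = Lc^{3(k+1)} · Lc^{k−i}`
  have hLP : Lc ^ (k + 1) / Lc ^ (i + 1) = Lc ^ (k - i) := by
    rw [Nat.pow_div (by omega) (Nat.pos_of_ne_zero (NeZero.ne Lc))]
    congr 1
    omega
  rw [hLP]
  push_cast
  -- the exponents: `5(k−i+1) + 4i = 3(k+1) + (k−i) + (k+2)`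
  have hcomb : ((Lc : ℝ) ^ (5 * (k - i + 1)))⁻¹ * ((Lc : ℝ) ^ ((3 + 1) * i))⁻¹
      = ((Lc : ℝ) ^ (3 * (k + 1) + (k - i)))⁻¹ * ((Lc : ℝ) ^ (k + 2))⁻¹ := by
    rw [← mul_inv, ← mul_inv, ← pow_add, ← pow_add]
    congr 2
    omega
  have hN0 : (Lc : ℝ) ^ (3 * (k + 1) + (k - i)) ≠ 0 := pow_ne_zero _ hne
  have hpow : ((Lc : ℝ) ^ (k + 1)) ^ 3 * (Lc : ℝ) ^ (k - i) = (Lc : ℝ) ^ (3 * (k + 1) + (k - i)) := by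
    rw [← pow_mul, ← pow_add, Nat.mul_comm]
  calc ((Lc : ℝ) ^ (k + 1)) ^ 3 * (Lc : ℝ) ^ (k - i) * J
      = (Lc : ℝ) ^ (3 * (k + 1) + (k - i)) *
          (2 * faceWtSum r Lc * (1 + 8 * (Lc : ℝ) * (Real.exp κ₀ + 1)) * C *
            (((Lc : ℝ) ^ (5 * (k - i + 1)))⁻¹ * ((Lc : ℝ) ^ ((3 + 1) * i))⁻¹) * Real.exp κ₀ * E) := by
        rw [hpow, hJ]; ring
    _ = 2 * faceWtSum r Lc * (1 + 8 * (Lc : ℝ) * (Real.exp κ₀ + 1)) * Real.exp κ₀ * C * ((Lc : ℝ) ^ (k + 2))⁻¹ * E *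
          ((Lc : ℝ) ^ (3 * (k + 1) + (k - i)) * ((Lc : ℝ) ^ (3 * (k + 1) + (k - i)))⁻¹) := by
        rw [hcomb]; ring
    _ = 2 * faceWtSum r Lc * (1 + 8 * (Lc : ℝ) * (Real.exp κ₀ + 1)) * Real.exp κ₀ * C * ((Lc : ℝ) ^ (k + 2))⁻¹ * E := by
        rw [mul_inv_cancel₀ hN0, mul_one]
    _ ≤ _ := le_rfl

/-! ## §4 The face sawtooth in block-ℓ¹ -/

/-- NOT IN PRINT; OUR BOOKKEEPING.  **THE FACE SAWTOOTH OF THE CONJUGATED (COMB-CHART) COMPOSITE LEGS IS `T^B`-SIZED IN BLOCK-ℓ¹** (`d = 3`, `[NeZero Lc]`, in-block roots `r` (face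
weights of `Ψ̂_S`) and `ρ = toSite rr` (dressing); parametric in leaf-12's (N1) data `κ₀ ≥ 0`, `C ≥ 0`): for ALL `m k μ z κ c`,
`Σ_{t ∈ box (Lc^{k+1})} |dz (PsiFace r ρ Lc m k (single μ z)) κ (Lc^{k+1}•c + t)| ≤ 2·(k+1)·faceWtSum r Lc·(1 + 8·Lc·(e^{κ₀}+1))·e^{κ₀}·C·(Lc^{k+2})⁻¹·e^{−κ₀‖c − z‖∞}` —
the `k+1` levels `m … m+k` contribute EQUALLY (§3).  Compare part 1 (`dz Ψ`: `16·k·Lc·e^{κ₀}·C·(Lc^{k+1})⁻¹`) and the undressed column (`C·(Lc^{k+1})⁻¹`): the face term of the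
comb chart costs NO power of the relative blocking `Lc^{k+1}` — the (III′) legs meet the block-ℓ¹ kernel-leg hypotheses of the (α-0) windows with a `(k+1)`-linear constant, as the (E) legs do. -/
theorem sum_box_abs_dz_PsiFace_single_le
    (m k : ℕ) (μ : Fin (3 + 1)) (z : Site (3 + 1)) (κ : Fin (3 + 1)) (c : Site (3 + 1)) :
    ∑ t ∈ box (3 + 1) (Lc ^ (k + 1)),
      |dz (PsiFace r (toSite rr) Lc m k (fun μ' y => if μ' = μ then (if y = z then (1 : ℝ) else 0) else 0)) κ
          (((Lc ^ (k + 1) : ℕ) : ℤ) • c + toSite t)|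
      ≤ 2 * ((k : ℝ) + 1) * faceWtSum r Lc * (1 + 8 * (Lc : ℝ) * (Real.exp κ₀ + 1)) * Real.exp κ₀ * C * ((Lc : ℝ) ^ (k + 2))⁻¹ *
          Real.exp (-(κ₀ * supNorm (c - z))) := by
  have hpt : ∀ t ∈ box (3 + 1) (Lc ^ (k + 1)),
      |dz (PsiFace r (toSite rr) Lc m k (fun μ' y => if μ' = μ then (if y = z then (1 : ℝ) else 0) else 0)) κ
          (((Lc ^ (k + 1) : ℕ) : ℤ) • c + toSite t)|
        ≤ ∑ i ∈ Finset.range (k + 1),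
          |((Lc : ℝ) ^ ((3 + 1) * i))⁻¹ *
              facePotential r Lc (legAct (legChain (respStepBmSeq (d := 3) (toSite rr) Lc) (m + i) (k - i))
                (fun μ' y => if μ' = μ then (if y = z then (1 : ℝ) else 0) else 0))
                  (blk (Lc ^ i) ((((Lc ^ (k + 1) : ℕ) : ℤ) • c + toSite t) + unitVec κ))
            - ((Lc : ℝ) ^ ((3 + 1) * i))⁻¹ *
              facePotential r Lc (legAct (legChain (respStepBmSeq (d := 3) (toSite rr) Lc) (m + i) (k - i))
                (fun μ' y => if μ' = μ then (if y = z then (1 : ℝ) else 0) else 0))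
                  (blk (Lc ^ i) (((Lc ^ (k + 1) : ℕ) : ℤ) • c + toSite t))| := by
    intro t _
    rw [dz_PsiFace_apply]
    exact Finset.abs_sum_le_sum_abs _ _
  refine (Finset.sum_le_sum hpt).trans ?_
  rw [Finset.sum_comm]
  refine (Finset.sum_le_sum fun i hi =>
    sum_box_abs_dz_PsiFaceTerm_single_le hκ hC hN1 hr hrr m k i (Nat.lt_succ_iff.1 (Finset.mem_range.1 hi)) μ z κ c).trans (le_of_eq ?_)
  rw [Finset.sum_const, Finset.card_range, nsmul_eq_mul]
  push_cast
  ring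

/-- NOT IN PRINT; OUR BOOKKEEPING.  **THE SAME IN PART 1's CURRENCY** (`(Lc^{k+2})⁻¹ ≤ (Lc^{k+1})⁻¹`, `Lc ≥ 1`): for ALL `m k μ z κ c`,
`Σ_{t ∈ box (Lc^{k+1})} |dz (PsiFace r ρ Lc m k (single μ z)) κ (Lc^{k+1}•c + t)| ≤ 2·(k+1)·faceWtSum r Lc·(1 + 8·Lc·(e^{κ₀}+1))·e^{κ₀}·C·(Lc^{k+1})⁻¹·e^{−κ₀‖c − z‖∞}` —
the shape of part 1's `sum_box_abs_dz_Psi_single_le` and of part 2, ready for the next word's triangle inequality. -/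
theorem sum_box_abs_dz_PsiFace_single_le'
    (m k : ℕ) (μ : Fin (3 + 1)) (z : Site (3 + 1)) (κ : Fin (3 + 1)) (c : Site (3 + 1)) :
    ∑ t ∈ box (3 + 1) (Lc ^ (k + 1)),
      |dz (PsiFace r (toSite rr) Lc m k (fun μ' y => if μ' = μ then (if y = z then (1 : ℝ) else 0) else 0)) κ
          (((Lc ^ (k + 1) : ℕ) : ℤ) • c + toSite t)|
      ≤ 2 * ((k : ℝ) + 1) * faceWtSum r Lc * (1 + 8 * (Lc : ℝ) * (Real.exp κ₀ + 1)) * Real.exp κ₀ * C * ((Lc : ℝ) ^ (k + 1))⁻¹ *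
          Real.exp (-(κ₀ * supNorm (c - z))) := by
  have hL1 : (1 : ℝ) ≤ Lc := by exact_mod_cast Nat.one_le_iff_ne_zero.2 (NeZero.ne Lc)
  have hpow : ((Lc : ℝ) ^ (k + 2))⁻¹ ≤ ((Lc : ℝ) ^ (k + 1))⁻¹ :=
    inv_anti₀ (by positivity) (pow_le_pow_right₀ hL1 (by omega))
  refine (sum_box_abs_dz_PsiFace_single_le hκ hC hN1 hr hrr m k μ z κ c).trans ?_
  have hF : 0 ≤ 2 * ((k : ℝ) + 1) * faceWtSum r Lc * (1 + 8 * (Lc : ℝ) * (Real.exp κ₀ + 1)) * Real.exp κ₀ * C := by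
    have := faceWtSum_nonneg r Lc
    positivity
  have hE : 0 ≤ Real.exp (-(κ₀ * supNorm (c - z))) := (Real.exp_pos _).le
  exact mul_le_mul_of_nonneg_right (mul_le_mul_of_nonneg_left hpow hF) hE

end Four

end Summit.QuantumFields.BalabanUV.Beta.GAN24.CombLegFaceSawtoothBlockL1

end
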